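import Literature.AlgebraicGeometry.Resolution.SmoothUniformizationProofs
import Literature.RingTheory.HilbertSamuel.MinimalPrimesCodim
import Mathlib.RingTheory.Ideal.GoingDown
import Mathlib.RingTheory.TensorProduct.Quotient
import Mathlib.RingTheory.KrullDimension.Field
import HarnessLib

/-!
# [OURS · L1 W4.2] Bricks for C4 P1 `AlgIsolatedOfIsolated` (W4.2 DEAL D15 «P1 PROOF»; crux `SigmaMaxModifications`
# stmt-ResolutionOfSingularities-18506, conjunct `SigmaMaxModificationsCorridor3` stmt-…-19249; `--supports stmt-…-19249`, helper)
# — part 4: coheights of minimal primes DESCEND along a flat local homomorphism with trivial closed fibre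

OURS (cell res-hironaka, slot W4.2, seat res-D-pv-042 AS W4.2 DEAL hand D15); NOT statements of H. Hironaka's manuscript
[Hironaka2017] nor of [CossartJannsenSaito2020]. AI-drafted, weaker than expert review. Sorry-free PROOF file (no new definition),
fact-free.

For a flat local homomorphism `(O, 𝔪_O) → (R, 𝔪_R)` of noetherian local rings with `𝔪_O R = 𝔪_R`:
* `ringKrullDim_quotient_map_eq_of_flat` — `dim R/qR = dim O/q` for every proper ideal `q` (Matsumura 15.1 for the flat local
  `O/q → R/qR`, whose closed fibre is the residue field);
* `le_ringKrullDim_quotient_of_mem_minimalPrimes_of_flat` — if every minimal prime `𝔓` of `R` has `n ≤ dim R/𝔓`, then every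
  minimal prime `q` of `O` has `n ≤ dim O/q` (going-down gives a prime, hence a minimal prime `𝔓 ⊇ qR`, of `R` over `q`, and
  `dim O/q = dim R/qR ≥ dim R/𝔓`);
* `le_minimalPrimesCodim_of_flat` — hence **`n ≤ ψ(O)`** (`ψ` = `minimalPrimesCodim`, CJS Def. 2.28 (2)). This is the
  `ψ`-half of CJS (2.13) «`H_{X̂}(x̂) = H_X(x)`», run through an arbitrary flat local `O → R` with trivial closed fibre instead
  of the completion.

## References

* V. Cossart, U. Jannsen, S. Saito, LNM 2270 (2020): Def. 2.28, Lemma 2.37 (2.13). [CossartJannsenSaito2020]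
* H. Matsumura, *Commutative Ring Theory* (1986), Thm. 9.5 (going down), Thm. 15.1. [Matsumura1987]
-/

noncomputable section

set_option linter.dupNamespace false -- mandated namespace of this single-conjunct summit

open IsLocalRing
open Literature.AlgebraicGeometry.Resolution Literature.RingTheory.HilbertSamuel

universe u

namespace Summit.ResolutionOfSingularities.ResolutionOfSingularities.Cruxes.SigmaMaxModifications.IdeasL1C4

variable {O R : Type u} [CommRing O] [CommRing R] [IsLocalRing O] [IsNoetherianRing O] [IsLocalRing R]
  [IsNoetherianRing R] [Algebra O R] [IsLocalHom (algebraMap O R)] [Module.Flat O R]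

/-- **`dim R/qR = dim O/q`** along a flat local homomorphism `O → R` of noetherian local rings with `𝔪_O R = 𝔪_R`, for
every proper ideal `q ⊂ O` (Matsumura 15.1 applied to the flat local `O/q → R/qR`, closed fibre `R/𝔪_R`).
[cite: Matsumura1987, Thm. 15.1] -/
theorem ringKrullDim_quotient_map_eq_of_flat (hm : (maximalIdeal O).map (algebraMap O R) = maximalIdeal R)
    (q : Ideal O) (hq : q ≠ ⊤) :
    ringKrullDim (R ⧸ q.map (algebraMap O R)) = ringKrullDim (O ⧸ q) := by
  have hqm : q ≤ maximalIdeal O := IsLocalRing.le_maximalIdeal hq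
  have hqR : q.map (algebraMap O R) ≠ ⊤ := by
    intro htop
    apply (maximalIdeal.isMaximal R).ne_top
    rw [← hm]
    exact top_le_iff.mp (htop ▸ Ideal.map_mono hqm)
  haveI : Nontrivial (O ⧸ q) := Ideal.Quotient.nontrivial_iff.mpr hq
  haveI : Nontrivial (R ⧸ q.map (algebraMap O R)) := Ideal.Quotient.nontrivial_iff.mpr hqR
  haveI : IsLocalRing (O ⧸ q) := .of_surjective' (Ideal.Quotient.mk q) Ideal.Quotient.mk_surjective
  haveI : IsLocalRing (R ⧸ q.map (algebraMap O R)) :=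
    .of_surjective' (Ideal.Quotient.mk _) Ideal.Quotient.mk_surjective
  haveI : Module.Flat (O ⧸ q) (R ⧸ q.map (algebraMap O R)) :=
    Module.Flat.of_linearEquiv (Algebra.TensorProduct.quotIdealMapEquivQuotTensor R q).toLinearEquiv
  haveI hmk : IsLocalHom (Ideal.Quotient.mk (q.map (algebraMap O R))) :=
    IsLocalHom.of_surjective _ Ideal.Quotient.mk_surjective
  haveI : IsLocalHom (algebraMap (O ⧸ q) (R ⧸ q.map (algebraMap O R))) := by
    refine ⟨fun x hx => ?_⟩
    obtain ⟨x, rfl⟩ := Ideal.Quotient.mk_surjective x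
    rw [Ideal.Quotient.algebraMap_quotient_map_quotient] at hx
    have h2 : IsUnit (algebraMap O R x) := IsLocalHom.map_nonunit _ hx
    exact (IsLocalHom.map_nonunit _ h2).map _
  have h := ringKrullDim_eq_add_of_flat (R := O ⧸ q) (S := R ⧸ q.map (algebraMap O R))
  -- the closed fibre of `O/q → R/qR` is the residue field of `R/qR`
  have hfib : (maximalIdeal (O ⧸ q)).map (algebraMap (O ⧸ q) (R ⧸ q.map (algebraMap O R))) =
      maximalIdeal (R ⧸ q.map (algebraMap O R)) := by
    rw [← map_maximalIdeal_of_surjective (Ideal.Quotient.mk q) Ideal.Quotient.mk_surjective, Ideal.map_map,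
      ← map_maximalIdeal_of_surjective (Ideal.Quotient.mk (q.map (algebraMap O R))) Ideal.Quotient.mk_surjective,
      ← hm, Ideal.map_map]
    congr 1
  haveI : (maximalIdeal (R ⧸ q.map (algebraMap O R))).IsMaximal := maximalIdeal.isMaximal _
  have hzero : ringKrullDim ((R ⧸ q.map (algebraMap O R)) ⧸
      (maximalIdeal (O ⧸ q)).map (algebraMap (O ⧸ q) (R ⧸ q.map (algebraMap O R)))) = 0 := by
    rw [ringKrullDim_eq_of_ringEquiv (Ideal.quotEquivOfEq hfib)]
    letI := Ideal.Quotient.field (maximalIdeal (R ⧸ q.map (algebraMap O R)))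
    exact ringKrullDim_eq_zero_of_field _
  rw [hzero, add_zero] at h
  exact h

/-- **Coheights of minimal primes descend along a flat local `O → R` with `𝔪_O R = 𝔪_R`**: if `n ≤ dim R/𝔓` for every
minimal prime `𝔓` of `R`, then `n ≤ dim O/q` for every minimal prime `q` of `O`. Going down (flatness) provides a prime of
`R` over `q` inside `𝔪_R`, any minimal prime `𝔓` of `R` below it still lies over the MINIMAL prime `q`, so `qR ⊆ 𝔓` and
`dim O/q = dim R/qR ≥ dim R/𝔓 ≥ n`. [cite: Matsumura1987, Thm. 9.5, Thm. 15.1] -/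
theorem le_ringKrullDim_quotient_of_mem_minimalPrimes_of_flat
    (hm : (maximalIdeal O).map (algebraMap O R) = maximalIdeal R) {n : WithBot ℕ∞}
    (hR : ∀ 𝔓 ∈ minimalPrimes R, n ≤ ringKrullDim (R ⧸ 𝔓)) {q : Ideal O} (hq : q ∈ minimalPrimes O) :
    n ≤ ringKrullDim (O ⧸ q) := by
  haveI := hq.1.1
  haveI : (maximalIdeal R).LiesOver (maximalIdeal O) := ⟨(maximalIdeal_comap (algebraMap O R)).symm⟩
  obtain ⟨𝔓, -, h𝔓p, h𝔓over⟩ := Ideal.exists_ideal_le_liesOver_of_le (maximalIdeal R)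
    (IsLocalRing.le_maximalIdeal (Ideal.IsPrime.ne_top (I := q) inferInstance))
  obtain ⟨𝔓', h𝔓', h𝔓'le⟩ := Ideal.exists_minimalPrimes_le (I := (⊥ : Ideal R)) (J := 𝔓) bot_le
  haveI := h𝔓'.1.1
  have hle1 : 𝔓'.comap (algebraMap O R) ≤ q := by
    calc 𝔓'.comap (algebraMap O R) ≤ 𝔓.comap (algebraMap O R) := Ideal.comap_mono h𝔓'le
      _ = q := (h𝔓over.over).symm
  have hunder : 𝔓'.comap (algebraMap O R) = q :=
    le_antisymm hle1 (hq.2 ⟨Ideal.comap_isPrime _ _, bot_le⟩ hle1)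
  have hmaple : q.map (algebraMap O R) ≤ 𝔓' := Ideal.map_le_iff_le_comap.mpr hunder.ge
  calc n ≤ ringKrullDim (R ⧸ 𝔓') := hR _ h𝔓'
    _ ≤ ringKrullDim (R ⧸ q.map (algebraMap O R)) :=
        ringKrullDim_le_of_surjective (Ideal.Quotient.factor hmaple) (Ideal.Quotient.factor_surjective hmaple)
    _ = ringKrullDim (O ⧸ q) := ringKrullDim_quotient_map_eq_of_flat hm q (Ideal.IsPrime.ne_top inferInstance)

/-- **`n ≤ ψ(O)`** when every minimal prime of `R` has coheight `≥ n`, along a flat local `O → R` with `𝔪_O R = 𝔪_R`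
(`ψ = minimalPrimesCodim`, CJS Def. 2.28 (2); the `ψ`-part of (2.13) without completing).
[cite: CossartJannsenSaito2020, Def. 2.28 (2), Lemma 2.37 (2)] [cite: Matsumura1987, Thm. 15.1] -/
theorem le_minimalPrimesCodim_of_flat (hm : (maximalIdeal O).map (algebraMap O R) = maximalIdeal R) {n : ℕ}
    (hR : ∀ 𝔓 ∈ minimalPrimes R, (n : WithBot ℕ∞) ≤ ringKrullDim (R ⧸ 𝔓)) : n ≤ minimalPrimesCodim O := by
  obtain ⟨q, hq, hdim⟩ := exists_minimalPrimes_ringKrullDim_eq_minimalPrimesCodim O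
  have h := le_ringKrullDim_quotient_of_mem_minimalPrimes_of_flat hm hR hq
  rw [hdim] at h
  exact_mod_cast h

end Summit.ResolutionOfSingularities.ResolutionOfSingularities.Cruxes.SigmaMaxModifications.IdeasL1C4

end
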